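import Summits.AtomisticToContinuum.Crystallization.Theorems.FrustratedLawDichotomyStrainedPatchPhaseCut

/-!
# The gradient residual `[OT-G]` cut by the RADIUS OF AFFINE FIT: core tube ∧ core-far, with the bridge at the core radius («CoreTube», lens-5 g47)

Lens-5 («finite / base range + asymptotic regime + bridge») node under «PhaseCut» (g46) → «HomTubeIso» (g46) → «HomTube» (p843977) → «CleanCollar»
(p843760) on the 27623 T-side piece `StrainedPatchRec`.  TARGET OF RECORD (critic ROW 832: «[OT-G] = THE RESIDUAL: non-affine single crystals
(bending / torsion), UNDECIDED · IDEA-NEEDED · INSTRUMENTABLE»):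
`MonoOffTubeFloor (63/10) (63/10) (1/100) (1/1000)` — admissible clusters, clean and of ONE stacking word on the whole `63/10`-ball, NO isometric copy of
whose `63/10`-ball is within `1/100` of an admissible homogeneous instance, have score `≥ 1/1000`.

THE DIAL of this node is the RADIUS `ρ` OUT TO WHICH THE CLUSTER IS COMPARED WITH AN AFFINE LATTICE (g46 cut the same ball by the radius of the
stacking WORD; g45 «HomTube» by the tube WIDTH `ε`; here the tube is cut by its LENGTH).  A bent or twisted single crystal with curvature / torsion
rate `κ` deviates from its best affine fit on the `ρ`-ball by `≍ κ·ρ²`: it is INSIDE the tube on a small core and OUTSIDE it on the full ball.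

* `NearHomAt ρ ε z c` (§1) := `NearHom ε z c` with the comparison radius `63/10` replaced by `ρ` (displacement, injectivity and covering clauses on the
  `ρ`-ball; `NearHomAt (63/10) ε ↔ NearHom ε` by `Iff.rfl`);  `NearHomIsoAt ρ ε` := modulo linear isometries, as in «HomTubeIso».
  RADIUS LADDER (PROVED, no sign condition): `NearHomAt ρ ε → NearHomAt ρ' ε` for `ρ' ≤ ρ` (the covering clause descends by the triangle inequality).
* PIECES (§2), inside the pure-stacking class of «PhaseCut» (`Admissible ∧ CleanBall r ∧ MonoPhaseBall r₁`):
  `MonoCoreTubeFloor r r₁ ρ ε φ` **[CORE TUBE]** — the `ρ`-core is `ε`-near-affine (mod isometry) ⟹ score `≥ φ`;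
  `CoreOffTubeFloor r r₁ ρ ε φ` **[CORE-FAR — THE RESIDUAL]** — even the `ρ`-core is `ε`-far from every admissible homogeneous instance ⟹ score `≥ φ`;
  `RimOffTubeFloor r r₁ ρ ε ρ' ε' φ` **[RIM]** — core near, the larger `ρ'`-ball `ε'`-far.
  EXACT CUTS by `em` (PROVED): `MonoTextureFloor r r₁ φ ↔ MonoCoreTubeFloor … ρ ε φ ∧ CoreOffTubeFloor … ρ ε φ` (every `ρ, ε`);  the CORE-RADIUS LADDER
  `CoreOffTubeFloor … ρ' ε' φ ↔ CoreOffTubeFloor … ρ ε φ ∧ RimOffTubeFloor … ρ ε ρ' ε' φ` (`ρ ≤ ρ'`, `ε' ≤ ε`): shrinking the comparison radius costs exactly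
  the rim piece;  at `ρ' = 63/10` this is `[OT-G] ↔ CoreOffTubeFloor … ρ ε φ ∧ RimOffTubeFloor … ρ ε (63/10) ε' φ` (`coreOffTubeFloor_record_iff` is `Iff.rfl`).
  Both new pieces are WEAKER than `[OT-G]` (necessity PROVED); the rim piece is ALSO implied by the core-tube piece (PROVED) — that is where it is discharged.
* THE BRIDGE AT THE CORE RADIUS (§3, the lens's typed bridge; tree `…CleanCollar` §7 `tailOut` / `TailPenalty` / `ballAvg_core_add_tail`):
  SIGN OF THE FAR TAIL (PROVED): `W₄₅ ≤ 0` on `[8/5, ∞)` (`= V·(1 − w₄₅)` with `V ≤ 0`, `ω₄ = 0`), hence `tailOut R M z c j ≤ 0` for every member `j` once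
  `R ≥ 17/5 = 9/5 + 8/5`, and `ballAvg (9/5) z (tailOut R M z c) c ≤ 0`;  so `HomFloor m → HomCoreFloor ρ m` (the homogeneous floor survives truncation
  of the functional at the core radius, PROVED) where `HomCoreFloor ρ m` := the CORE functional `x_j − tailOut ρ` has ball average `≥ m` on admissible
  homogeneous instances [CERT, same programme as (H)];  `CoreCoreRelief r r₁ ρ ε A` **[PERTURBATIVE: force-capped linear response INSIDE the core tube]**
  := on the core-tube class some admissible homogeneous instance has CORE value at most `A` above the cluster's CORE value;  SEAMS (PROVED):
  `HomCoreFloor ρ m → TailPenalty ρ μ → CoreCoreRelief r r₁ ρ ε A → φ + A + μ ≤ m → MonoCoreTubeFloor r r₁ ρ ε φ` and, for `ρ ≥ 17/5`, the same from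
  `HomFloor m`;  where the relief sits (`coreCoreRelief_of_monoCoreTubeFloor_of_witness`, PROVED).
* NODES (§4, PROVED, all floors universally quantified `≥ 0` — Lean fixes no census number, critic ROW 800):
  `MonoCoreTubeFloor → CoreOffTubeFloor → AnnularPhaseFloor → PolyTextureFloor → AnnularDefectFloor (24/5) (63/10) → DefectiveCollarFloor (24/5) → StrainedPatchRec`;
  `HomFloor m → TailPenalty ρ μ → CoreCoreRelief (63/10) (63/10) ρ ε A → A + μ ≤ m → CoreOffTubeFloor (63/10) (63/10) ρ ε φ₁ → [FF] φ₂ → [OT-F] φ₃ → … → StrainedPatchRec`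
  (`ρ ≥ 17/5`; NO `TubeRelief`, NO rim piece: the core-tube class swallows g46's tube AND the rim);  the same from `HomCoreFloor ρ m` (any `ρ`);  the split
  of record fed into g46's record node (`HomFloor (1/625) → TubeRelief … → CoreOffTubeFloor … → RimOffTubeFloor … → …`);  RECORD LITERALS `ρ = 24/5`,
  `ε = 1/100`, `m = 1/625`, `μ = 1/1000` (`TailPenalty (24/5) (1/1000)`, the g45 literal), `A = 3/5000` (`seam_arith_core : 3/5000 + 1/1000 ≤ 1/625`).

THE LENS'S ANSWER («how far in must the affine comparison reach for the bridge to bite»): `ρ* = 24/5 = 9/5 + 3` = members + the Lennard-Jones CORE range of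
`W₄₅`.  For `ρ ≥ 24/5` every pair (member, site beyond `ρ`) has distance `≥ 3`, i.e. lies in the C¹ splice window where `W₄₅ = V·(1 − S₁) ∈ [V 3, 0]`,
`|W₄₅| ≤ 2.28e-4`: the far tail is SIGNED (§3) and SMALL (g45 `out/tailsplit_*.json`: `−5.23e-4` on the record texture, `−5.2e-4 / −6.8e-4` on the hcp / fcc
floor instances, against the margin `m − S_knife = 1.6e-3 − 1.82e-3 …` — i.e. against the (H) floor `1/625` the budget `A + μ = 6e-4` closes the seam with
`μ = 1e-3 ≥ 1.9 ×` the measured tail and `A = 6e-4 ≥ 2.3 ×` the measured core relief `2.6e-4` = core value of the record texture `2.344e-3` below the hcp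
floor core `2.597e-3`).  Below `24/5` members' partners in the LJ core (`|W₄₅|` up to `2e-2` per pair, tail `−4.0e-3` at `ρ = 4.05`, `−2.0e-2` at `3.3`)
leave the controlled region: no perturbative bridge — there the bridge would have to be strain-GRADIENT (second-order Cauchy–Born) elasticity, which is
the mechanism the residual `CoreOffTubeFloor (63/10) (63/10) (24/5) (1/100) φ` now isolates ON THE FORCE-CAPPED CORE: an admissible, clean, single-word
cluster whose `24/5`-core (≈ 80 atoms under the force cap `σ₁` and `1/20`-badness) is `1/100`-far, modulo rotation, from every admissible affine fcc / hcp
instance — curvature radius `≲ 24` lattice spacings at the centre.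

TAGS.  `MonoCoreTubeFloor` [CORE TUBE]: WEAKER · MECHANISM-NAMED ((H) truncated + signed tail + force-capped linear response in the core) · discharged
modulo `CoreCoreRelief` [PERTURBATIVE, INSTRUMENTABLE: ε ↦ core relief profile] and `TailPenalty` [PACKING].  `CoreOffTubeFloor (…) (24/5) (1/100) φ`
[CORE-FAR]: WEAKER than `[OT-G]` · THE RESIDUAL · UNDECIDED · IDEA-NEEDED (strain-gradient elasticity under the force cap: does `σ₁` on an `80`-atom core
bound the curvature so that `ε*(24/5) < 1/100`, making the piece VACUOUS, or do admissible strongly bent cores exist and score `≥ φ`?) · INSTRUMENTABLE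
(census: the profile `ε*_iso(ρ)` of the on-file torsion / bending textures at `ρ = 24/5, 5.55, 63/10`; kill = an admissible clean single-word cluster
with `ε*_iso(24/5) ≥ 1/100` and score `< φ`).  `RimOffTubeFloor` [RIM]: WEAKER · DISCHARGED inside the core tube (PROVED implication).
`HomCoreFloor (24/5) m` [CERT]: the (H) programme on the truncated functional (float: hcp `2.597e-3`, fcc `4.082e-3`).

HONESTY.  The cuts are case splits (`em` on `NearHomIsoAt ρ ε`); their content is WHERE they cut: at `ρ = 24/5` the core-near side is reached by the
tree's own bridge pieces (signed far tail, `TailPenalty`) plus (H) and a core-local relief law, and the core-far side is the statement that strongly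
curved force-capped single crystals pay — two different engines.  Neither new piece alone gives `[OT-G]`, the pure-stacking piece or the target;
`NearHomIsoAt (24/5) ε ↛ NearHomIso ε`; no piece is provable or refutable outright in scope; the seam needs each hypothesis (must-fail probes
`g47/check/CoreTubeProbes.lean`).  No sorry, no new axioms, no cite tokens, no instances / notation.
Evidence: `run/shared/lean/pub/decomp-a2c/decomp-a2c-lens-5/g47/{NODE-g47.md, out/, scripts/, check/}`.

FILE SPLIT (critic ROW 841 (5), 400-line lint): THIS FILE = §1–§2 (the tube at radius `ρ`, its ladder and isometry quotient; the pieces, the exact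
cuts, necessity, dials).  §3–§4 (signed far tail, truncated homogeneous floor, core relief, seams, record nodes) = the sequel
`…Theorems.FrustratedLawDichotomyStrainedPatchCoreTubeRecord` (imports this file).
-/

namespace Summit.AtomisticToContinuum.Crystallization.Theorems.FrustratedLawDichotomyStrainedPatchCoreTube

open scoped BigOperators Classical
open Literature.MathematicalPhysics.StatisticalMechanics (lennardJones lennardJones_nonpos)
open Summit.AtomisticToContinuum.Crystallization.Theorems.FrustratedLawDichotomyRangeCut
open Summit.AtomisticToContinuum.Crystallization.Theorems.FrustratedLawDichotomySchurCut
open Summit.AtomisticToContinuum.Crystallization.Theorems.FrustratedLawDichotomyMotifLemmas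
open Summit.AtomisticToContinuum.Crystallization.Theorems.FrustratedLawDichotomyAveragingCut
open Summit.AtomisticToContinuum.Crystallization.Theorems.FrustratedLawDichotomyAveragingRuleCap
open Summit.AtomisticToContinuum.Crystallization.Theorems.FrustratedLawDichotomyAveragingRuleTightFree
open Summit.AtomisticToContinuum.Crystallization.Theorems.FrustratedLawDichotomyRuleToolkitGood (goodFlag)
open Summit.AtomisticToContinuum.Crystallization.Theorems.FrustratedLawDichotomyExemptDoor (SitePred)
open Summit.AtomisticToContinuum.Crystallization.Theorems.FrustratedLawDichotomyExemptAbsorption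
open Summit.AtomisticToContinuum.Crystallization.Theorems.FrustratedLawDichotomyExemptAbsorptionRecord
open Summit.AtomisticToContinuum.Crystallization.Theorems.FrustratedLawDichotomyCollarCensus
open Summit.AtomisticToContinuum.Crystallization.Theorems.FrustratedLawDichotomyCollarCensusKappa
open Summit.AtomisticToContinuum.Crystallization.Theorems.FrustratedLawDichotomyStrainedPatchHomSplit
open Summit.AtomisticToContinuum.Crystallization.Theorems.FrustratedLawDichotomyStrainedPatchCleanCollar
open Summit.AtomisticToContinuum.Crystallization.Theorems.FrustratedLawDichotomyStrainedPatchHomTube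
open Summit.AtomisticToContinuum.Crystallization.Theorems.FrustratedLawDichotomyStrainedPatchHomIsometry
open Summit.AtomisticToContinuum.Crystallization.Theorems.FrustratedLawDichotomyStrainedPatchHomTubeIso
open Summit.AtomisticToContinuum.Crystallization.Theorems.FrustratedLawDichotomyStrainedPatchPhaseCut

/-! ## §1. The tube at comparison radius `ρ`, its radius ladder, and the quotient by isometries -/

/-- **`NearHomAt ρ ε z c`** — `NearHom ε z c` (lens-5 g44/g45) with the comparison radius `63/10` replaced by `ρ`: the `ρ`-ball of the cluster around its
centre is, atom by atom and in position relative to the centres, within `ε` of the corresponding part of SOME admissible homogeneous instance — injective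
correspondence on the `ρ`-ball, covering the instance's `ρ`-ball shrunk by `ε`. -/
def NearHomAt (ρ ε : ℝ) {M : ℕ} (z : Fin M → E3) (c : Fin M) : Prop :=
  ∃ (M₀ : ℕ) (z₀ : Fin M₀ → E3) (c₀ : Fin M₀) (e : Fin M → Fin M₀), Admissible M₀ z₀ c₀ ∧ IsHomBall (133 / 10) z₀ c₀ ∧ e c = c₀ ∧
    (∀ a, dist (z a) (z c) ≤ ρ → dist (z a - z c) (z₀ (e a) - z₀ c₀) ≤ ε) ∧
    (∀ a b, dist (z a) (z c) ≤ ρ → dist (z b) (z c) ≤ ρ → e a = e b → a = b) ∧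
    (∀ b₀, dist (z₀ b₀) (z₀ c₀) ≤ ρ - ε → ∃ a, dist (z a) (z c) ≤ ρ ∧ e a = b₀)

/-- At the record radius the predicate IS «HomTube»'s: `NearHomAt (63/10) ε z c ↔ NearHom ε z c`. [formal bookkeeping] -/
theorem nearHomAt_record_iff (ε : ℝ) {M : ℕ} (z : Fin M → E3) (c : Fin M) : NearHomAt (63 / 10) ε z c ↔ NearHom ε z c := Iff.rfl

/-- The tube at radius `ρ` widens with `ε`. [folklore] -/
theorem NearHomAt.mono {ρ ε ε' : ℝ} {M : ℕ} {z : Fin M → E3} {c : Fin M} (h : NearHomAt ρ ε z c) (hle : ε ≤ ε') : NearHomAt ρ ε' z c := by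
  obtain ⟨M₀, z₀, c₀, e, h₀, hhom, hc, hdisp, hinj, hcov⟩ := h
  refine ⟨M₀, z₀, c₀, e, h₀, hhom, hc, fun a ha => (hdisp a ha).trans hle, hinj, fun b₀ hb₀ => hcov b₀ ?_⟩
  linarith

/-- ★ RADIUS LADDER: near-affine out to `ρ` ⟹ near-affine out to every `ρ' ≤ ρ` (same instance, same correspondence; the covering clause descends by the
triangle inequality: an instance point within `ρ' − ε` of the instance centre is matched by a cluster atom within `ρ'` of the centre). [folklore] -/
theorem NearHomAt.of_le_radius {ρ ρ' ε : ℝ} {M : ℕ} {z : Fin M → E3} {c : Fin M} (h : NearHomAt ρ ε z c) (hle : ρ' ≤ ρ) :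
    NearHomAt ρ' ε z c := by
  obtain ⟨M₀, z₀, c₀, e, h₀, hhom, hc, hdisp, hinj, hcov⟩ := h
  refine ⟨M₀, z₀, c₀, e, h₀, hhom, hc, fun a ha => hdisp a (ha.trans hle),
    fun a b ha hb => hinj a b (ha.trans hle) (hb.trans hle), fun b₀ hb₀ => ?_⟩
  obtain ⟨a, ha, hab⟩ := hcov b₀ (by linarith)
  refine ⟨a, ?_, hab⟩
  have hd := hdisp a ha
  rw [hab] at hd
  have h1 : dist (z a) (z c) = dist (z a - z c) 0 := by rw [dist_zero_right, dist_eq_norm]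
  have h2 : dist (z₀ b₀) (z₀ c₀) = dist (z₀ b₀ - z₀ c₀) 0 := by rw [dist_zero_right, dist_eq_norm]
  have htri := dist_triangle (z a - z c) (z₀ b₀ - z₀ c₀) 0
  linarith

/-- **`NearHomIsoAt ρ ε z c`** — SOME ISOMETRIC COPY of the cluster is `NearHomAt ρ ε` (the `ρ`-core is near-affine modulo a linear isometry of `E3`). -/
def NearHomIsoAt (ρ ε : ℝ) {M : ℕ} (z : Fin M → E3) (c : Fin M) : Prop :=
  ∃ R : E3 ≃ₗᵢ[ℝ] E3, NearHomAt ρ ε (⇑R ∘ z) c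

/-- At the record radius: `NearHomIsoAt (63/10) ε z c ↔ NearHomIso ε z c`. [formal bookkeeping] -/
theorem nearHomIsoAt_record_iff (ε : ℝ) {M : ℕ} (z : Fin M → E3) (c : Fin M) : NearHomIsoAt (63 / 10) ε z c ↔ NearHomIso ε z c := Iff.rfl

/-- The frame-fixed core tube lies inside the quotiented one (`R = 1`). [formal bookkeeping] -/
theorem nearHomIsoAt_of_nearHomAt {ρ ε : ℝ} {M : ℕ} {z : Fin M → E3} {c : Fin M} (h : NearHomAt ρ ε z c) : NearHomIsoAt ρ ε z c :=
  ⟨LinearIsometryEquiv.refl ℝ E3, by rw [LinearIsometryEquiv.coe_refl, Function.id_comp]; exact h⟩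

/-- The quotiented core tube widens with `ε`. [folklore] -/
theorem NearHomIsoAt.mono {ρ ε ε' : ℝ} {M : ℕ} {z : Fin M → E3} {c : Fin M} (h : NearHomIsoAt ρ ε z c) (hle : ε ≤ ε') : NearHomIsoAt ρ ε' z c := by
  obtain ⟨R, h⟩ := h
  exact ⟨R, h.mono hle⟩

/-- ★ RADIUS LADDER modulo isometry: `NearHomIsoAt ρ ε → NearHomIsoAt ρ' ε` for `ρ' ≤ ρ`. [folklore] -/
theorem NearHomIsoAt.of_le_radius {ρ ρ' ε : ℝ} {M : ℕ} {z : Fin M → E3} {c : Fin M} (h : NearHomIsoAt ρ ε z c) (hle : ρ' ≤ ρ) :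
    NearHomIsoAt ρ' ε z c := by
  obtain ⟨R, h⟩ := h
  exact ⟨R, h.of_le_radius hle⟩

/-- The g46 tube gives every core tube: `NearHomIso ε' z c → ρ ≤ 63/10 → ε' ≤ ε → NearHomIsoAt ρ ε z c`. [folklore] -/
theorem nearHomIsoAt_of_nearHomIso {ρ ε ε' : ℝ} {M : ℕ} {z : Fin M → E3} {c : Fin M} (h : NearHomIso ε' z c) (hρ : ρ ≤ 63 / 10) (hε : ε' ≤ ε) :
    NearHomIsoAt ρ ε z c :=
  (((nearHomIsoAt_record_iff ε' z c).2 h).of_le_radius hρ).mono hε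

/-- The quotiented core tube is itself isometry-invariant. [folklore] -/
theorem nearHomIsoAt_comp_iff (R : E3 ≃ₗᵢ[ℝ] E3) {ρ ε : ℝ} {M : ℕ} (z : Fin M → E3) (c : Fin M) :
    NearHomIsoAt ρ ε (⇑R ∘ z) c ↔ NearHomIsoAt ρ ε z c := by
  constructor
  · rintro ⟨R₀, h⟩
    refine ⟨R.trans R₀, ?_⟩
    have : ⇑(R.trans R₀) ∘ z = ⇑R₀ ∘ (⇑R ∘ z) := by funext a; simp
    rw [this]; exact h
  · rintro ⟨R₀, h⟩
    refine ⟨R.symm.trans R₀, ?_⟩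
    have : ⇑(R.symm.trans R₀) ∘ (⇑R ∘ z) = ⇑R₀ ∘ z := by funext a; simp
    rw [this]; exact h

/-! ## §2. The pure-stacking piece cut by the comparison radius: core tube ∧ core-far, the core-radius ladder, necessity, dials -/

/-- **`MonoCoreTubeFloor r r₁ ρ ε φ` [CORE TUBE]** — on admissible clusters clean within `r`, of one stacking word out to `r₁`, whose `ρ`-core is `ε`-near-affine
modulo isometry, the score is `≥ φ`. -/
def MonoCoreTubeFloor (r r₁ ρ ε φ : ℝ) : Prop :=
  ∀ (M : ℕ) (z : Fin M → E3) (c : Fin M), Admissible M z c → CleanBall r z c → MonoPhaseBall r₁ z c → NearHomIsoAt ρ ε z c →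
    φ ≤ ballAvg (9 / 5) z (xRec M z) c

/-- **`CoreOffTubeFloor r r₁ ρ ε φ` [CORE-FAR — THE RESIDUAL]** — on admissible clusters clean within `r`, of one stacking word out to `r₁`, whose `ρ`-CORE is
`ε`-far modulo isometry from every admissible homogeneous instance (strongly curved single crystals), the score is `≥ φ`. -/
def CoreOffTubeFloor (r r₁ ρ ε φ : ℝ) : Prop :=
  ∀ (M : ℕ) (z : Fin M → E3) (c : Fin M), Admissible M z c → CleanBall r z c → MonoPhaseBall r₁ z c → ¬NearHomIsoAt ρ ε z c →
    φ ≤ ballAvg (9 / 5) z (xRec M z) c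

/-- **`RimOffTubeFloor r r₁ ρ ε ρ' ε' φ` [RIM]** — the `ρ`-core is `ε`-near-affine but the `ρ'`-ball is `ε'`-far (mildly curved single crystals: inside the
tube on the core, outside it on the rim). -/
def RimOffTubeFloor (r r₁ ρ ε ρ' ε' φ : ℝ) : Prop :=
  ∀ (M : ℕ) (z : Fin M → E3) (c : Fin M), Admissible M z c → CleanBall r z c → MonoPhaseBall r₁ z c → NearHomIsoAt ρ ε z c →
    ¬NearHomIsoAt ρ' ε' z c → φ ≤ ballAvg (9 / 5) z (xRec M z) c

/-- At the record radius the core-far piece IS g46's gradient residual: `CoreOffTubeFloor r r₁ (63/10) ε φ ↔ MonoOffTubeFloor r r₁ ε φ`. [formal bookkeeping] -/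
theorem coreOffTubeFloor_record_iff (r r₁ ε φ : ℝ) : CoreOffTubeFloor r r₁ (63 / 10) ε φ ↔ MonoOffTubeFloor r r₁ ε φ := Iff.rfl

/-- At the record radius and level `0` the core-tube piece IS g46's tube piece: `MonoCoreTubeFloor r r₁ (63/10) ε 0 ↔ MonoTubeFloor r r₁ ε`. [formal bookkeeping] -/
theorem monoCoreTubeFloor_record_iff (r r₁ ε : ℝ) : MonoCoreTubeFloor r r₁ (63 / 10) ε 0 ↔ MonoTubeFloor r r₁ ε := Iff.rfl

/-- ★ EXACT CUT of the pure-stacking piece by the core tube (every `ρ, ε, φ`):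
`MonoTextureFloor r r₁ φ ↔ MonoCoreTubeFloor r r₁ ρ ε φ ∧ CoreOffTubeFloor r r₁ ρ ε φ`. [folklore: `em` on `NearHomIsoAt ρ ε`] -/
theorem monoTextureFloor_iff_coreTube_and_coreOff (r r₁ ρ ε φ : ℝ) :
    MonoTextureFloor r r₁ φ ↔ MonoCoreTubeFloor r r₁ ρ ε φ ∧ CoreOffTubeFloor r r₁ ρ ε φ := by
  constructor
  · intro h
    exact ⟨fun M z c hz hcl hm _ => h M z c hz hcl hm, fun M z c hz hcl hm _ => h M z c hz hcl hm⟩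
  · rintro ⟨hT, hO⟩ M z c hz hcl hm
    by_cases hn : NearHomIsoAt ρ ε z c
    · exact hT M z c hz hcl hm hn
    · exact hO M z c hz hcl hm hn

/-- NECESSITY of the core-tube piece. [folklore] -/
theorem monoCoreTubeFloor_of_monoTextureFloor {r r₁ φ : ℝ} (ρ ε : ℝ) (h : MonoTextureFloor r r₁ φ) : MonoCoreTubeFloor r r₁ ρ ε φ :=
  ((monoTextureFloor_iff_coreTube_and_coreOff r r₁ ρ ε φ).1 h).1

/-- NECESSITY of the core-far piece. [folklore] -/
theorem coreOffTubeFloor_of_monoTextureFloor {r r₁ φ : ℝ} (ρ ε : ℝ) (h : MonoTextureFloor r r₁ φ) : CoreOffTubeFloor r r₁ ρ ε φ :=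
  ((monoTextureFloor_iff_coreTube_and_coreOff r r₁ ρ ε φ).1 h).2

/-- ★ THE CORE-RADIUS LADDER (`ρ ≤ ρ'`, `ε' ≤ ε`): `CoreOffTubeFloor r r₁ ρ' ε' φ ↔ CoreOffTubeFloor r r₁ ρ ε φ ∧ RimOffTubeFloor r r₁ ρ ε ρ' ε' φ` — shrinking the
comparison radius (and widening the tube) costs exactly the rim piece. [folklore: radius ladder + `em`] -/
theorem coreOffTubeFloor_iff_core_and_rim {r r₁ ρ ε ρ' ε' φ : ℝ} (hρ : ρ ≤ ρ') (hε : ε' ≤ ε) :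
    CoreOffTubeFloor r r₁ ρ' ε' φ ↔ CoreOffTubeFloor r r₁ ρ ε φ ∧ RimOffTubeFloor r r₁ ρ ε ρ' ε' φ := by
  constructor
  · intro h
    exact ⟨fun M z c hz hcl hm hn => h M z c hz hcl hm fun hn' => hn ((hn'.of_le_radius hρ).mono hε),
      fun M z c hz hcl hm _ hn' => h M z c hz hcl hm hn'⟩
  · rintro ⟨hC, hR⟩ M z c hz hcl hm hn'
    by_cases hn : NearHomIsoAt ρ ε z c
    · exact hR M z c hz hcl hm hn hn'
    · exact hC M z c hz hcl hm hn

/-- ★ THE CUT OF RECORD SHAPE: `[OT-G] = MonoOffTubeFloor r r₁ ε' φ ↔ CoreOffTubeFloor r r₁ ρ ε φ ∧ RimOffTubeFloor r r₁ ρ ε (63/10) ε' φ` (`ρ ≤ 63/10`, `ε' ≤ ε`). [folklore] -/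
theorem monoOffTubeFloor_iff_coreOff_and_rim {r r₁ ρ ε ε' φ : ℝ} (hρ : ρ ≤ 63 / 10) (hε : ε' ≤ ε) :
    MonoOffTubeFloor r r₁ ε' φ ↔ CoreOffTubeFloor r r₁ ρ ε φ ∧ RimOffTubeFloor r r₁ ρ ε (63 / 10) ε' φ := by
  rw [← coreOffTubeFloor_record_iff]
  exact coreOffTubeFloor_iff_core_and_rim hρ hε

/-- The two pieces of the record shape give `[OT-G]` back. [folklore] -/
theorem monoOffTubeFloor_of_coreOff_of_rim {r r₁ ρ ε ε' φ : ℝ} (hρ : ρ ≤ 63 / 10) (hε : ε' ≤ ε) (hC : CoreOffTubeFloor r r₁ ρ ε φ)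
    (hR : RimOffTubeFloor r r₁ ρ ε (63 / 10) ε' φ) : MonoOffTubeFloor r r₁ ε' φ :=
  (monoOffTubeFloor_iff_coreOff_and_rim hρ hε).2 ⟨hC, hR⟩

/-- NECESSITY: `[OT-G]` gives the core-far piece (so `CoreOffTubeFloor … ρ …` is WEAKER than `[OT-G]` for `ρ ≤ 63/10`). [folklore] -/
theorem coreOffTubeFloor_of_monoOffTubeFloor {r r₁ ρ ε ε' φ : ℝ} (hρ : ρ ≤ 63 / 10) (hε : ε' ≤ ε) (h : MonoOffTubeFloor r r₁ ε' φ) :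
    CoreOffTubeFloor r r₁ ρ ε φ :=
  ((monoOffTubeFloor_iff_coreOff_and_rim hρ hε).1 h).1

/-- NECESSITY: `[OT-G]` gives the rim piece. [folklore] -/
theorem rimOffTubeFloor_of_monoOffTubeFloor {r r₁ ε' φ : ℝ} (ρ ε : ℝ) (h : MonoOffTubeFloor r r₁ ε' φ) :
    RimOffTubeFloor r r₁ ρ ε (63 / 10) ε' φ :=
  fun M z c hz hcl hm _ hn' => h M z c hz hcl hm hn'

/-- ★ WHERE THE RIM IS DISCHARGED: the core-tube piece gives every rim piece over the same core. [formal bookkeeping] -/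
theorem rimOffTubeFloor_of_monoCoreTubeFloor {r r₁ ρ ε φ : ℝ} (ρ' ε' : ℝ) (h : MonoCoreTubeFloor r r₁ ρ ε φ) :
    RimOffTubeFloor r r₁ ρ ε ρ' ε' φ :=
  fun M z c hz hcl hm hn _ => h M z c hz hcl hm hn

/-- The core-tube ladder (`ρ ≤ ρ'`, `ε' ≤ ε`): `MonoCoreTubeFloor r r₁ ρ ε φ ↔ MonoCoreTubeFloor r r₁ ρ' ε' φ ∧ RimOffTubeFloor r r₁ ρ ε ρ' ε' φ` — the core
tube is the longer tube plus the rim. [folklore] -/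
theorem monoCoreTubeFloor_iff_longer_and_rim {r r₁ ρ ε ρ' ε' φ : ℝ} (hρ : ρ ≤ ρ') (hε : ε' ≤ ε) :
    MonoCoreTubeFloor r r₁ ρ ε φ ↔ MonoCoreTubeFloor r r₁ ρ' ε' φ ∧ RimOffTubeFloor r r₁ ρ ε ρ' ε' φ := by
  constructor
  · intro h
    exact ⟨fun M z c hz hcl hm hn' => h M z c hz hcl hm ((hn'.of_le_radius hρ).mono hε), rimOffTubeFloor_of_monoCoreTubeFloor ρ' ε' h⟩
  · rintro ⟨hT, hR⟩ M z c hz hcl hm hn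
    by_cases hn' : NearHomIsoAt ρ' ε' z c
    · exact hT M z c hz hcl hm hn'
    · exact hR M z c hz hcl hm hn hn'

/-- g46's tube piece plus the rim give the core tube at level `0` (`ρ ≤ 63/10`, `ε' ≤ ε`, rim floor `≥ 0`). [folklore] -/
theorem monoCoreTubeFloor_zero_of_monoTube_of_rim {r r₁ ρ ε ε' φ : ℝ} (hρ : ρ ≤ 63 / 10) (hε : ε' ≤ ε) (hT : MonoTubeFloor r r₁ ε')
    (hR : RimOffTubeFloor r r₁ ρ ε (63 / 10) ε' φ) (hφ : 0 ≤ φ) : MonoCoreTubeFloor r r₁ ρ ε 0 :=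
  (monoCoreTubeFloor_iff_longer_and_rim hρ hε).2
    ⟨(monoCoreTubeFloor_record_iff r r₁ ε').2 hT, fun M z c hz hcl hm hn hn' => hφ.trans (hR M z c hz hcl hm hn hn')⟩

/-- SEAM of the cut: `MonoCoreTubeFloor (φ₀ ≥ 0) → CoreOffTubeFloor (φ₁ ≥ 0) → MonoTextureFloor r r₁ 0`. [folklore] -/
theorem monoTextureFloor_zero_of_coreTube_of_coreOff {r r₁ ρ ε φ₀ φ₁ : ℝ} (hT : MonoCoreTubeFloor r r₁ ρ ε φ₀) (hC : CoreOffTubeFloor r r₁ ρ ε φ₁)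
    (h₀ : 0 ≤ φ₀) (h₁ : 0 ≤ φ₁) : MonoTextureFloor r r₁ 0 :=
  (monoTextureFloor_iff_coreTube_and_coreOff r r₁ ρ ε 0).2
    ⟨fun M z c hz hcl hm hn => h₀.trans (hT M z c hz hcl hm hn), fun M z c hz hcl hm hn => h₁.trans (hC M z c hz hcl hm hn)⟩

/-- DIALS of the residual: antitone in `φ`. [folklore] -/
theorem CoreOffTubeFloor.of_le {r r₁ ρ ε φ φ' : ℝ} (h : CoreOffTubeFloor r r₁ ρ ε φ) (hle : φ' ≤ φ) : CoreOffTubeFloor r r₁ ρ ε φ' :=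
  fun M z c hz hcl hm hn => hle.trans (h M z c hz hcl hm hn)

/-- … monotone in `ε` (a wider tube leaves fewer core-far clusters). [folklore] -/
theorem CoreOffTubeFloor.mono {r r₁ ρ ε ε' φ : ℝ} (h : CoreOffTubeFloor r r₁ ρ ε φ) (hle : ε ≤ ε') : CoreOffTubeFloor r r₁ ρ ε' φ :=
  fun M z c hz hcl hm hn => h M z c hz hcl hm fun hn' => hn (hn'.mono hle)

/-- … WEAKENS as the comparison radius SHRINKS (`ρ' ≤ ρ`): fewer clusters are far already on the smaller core. [folklore] -/
theorem CoreOffTubeFloor.of_le_core {r r₁ ρ ρ' ε φ : ℝ} (h : CoreOffTubeFloor r r₁ ρ ε φ) (hle : ρ' ≤ ρ) : CoreOffTubeFloor r r₁ ρ' ε φ :=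
  fun M z c hz hcl hm hn => h M z c hz hcl hm fun hn' => hn (hn'.of_le_radius hle)

/-- … weakens as the word radius `r₁` grows, monotone in the clean radius `r`. [folklore] -/
theorem CoreOffTubeFloor.of_le_word {r r₁ r₁' ρ ε φ : ℝ} (h : CoreOffTubeFloor r r₁ ρ ε φ) (hle : r₁ ≤ r₁') : CoreOffTubeFloor r r₁' ρ ε φ :=
  fun M z c hz hcl hm hn => h M z c hz hcl (hm.mono hle) hn

/-- Monotonicity bookkeeping (`CoreOffTubeFloor.of_le_radius`). -/
theorem CoreOffTubeFloor.of_le_radius {r r' r₁ ρ ε φ : ℝ} (h : CoreOffTubeFloor r r₁ ρ ε φ) (hle : r ≤ r') : CoreOffTubeFloor r' r₁ ρ ε φ :=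
  fun M z c hz hcl hm hn => h M z c hz (hcl.mono hle) hm hn

/-- DIALS of the core tube: antitone in `φ`, antitone in `ε`, monotone in `ρ`. [folklore] -/
theorem MonoCoreTubeFloor.of_le {r r₁ ρ ε φ φ' : ℝ} (h : MonoCoreTubeFloor r r₁ ρ ε φ) (hle : φ' ≤ φ) : MonoCoreTubeFloor r r₁ ρ ε φ' :=
  fun M z c hz hcl hm hn => hle.trans (h M z c hz hcl hm hn)

/-- Monotonicity bookkeeping (`MonoCoreTubeFloor.anti`). -/
theorem MonoCoreTubeFloor.anti {r r₁ ρ ε ε' φ : ℝ} (h : MonoCoreTubeFloor r r₁ ρ ε φ) (hle : ε' ≤ ε) : MonoCoreTubeFloor r r₁ ρ ε' φ :=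
  fun M z c hz hcl hm hn => h M z c hz hcl hm (hn.mono hle)

/-- Monotonicity bookkeeping (`MonoCoreTubeFloor.of_le_core`). -/
theorem MonoCoreTubeFloor.of_le_core {r r₁ ρ ρ' ε φ : ℝ} (h : MonoCoreTubeFloor r r₁ ρ ε φ) (hle : ρ ≤ ρ') : MonoCoreTubeFloor r r₁ ρ' ε φ :=
  fun M z c hz hcl hm hn => h M z c hz hcl hm (hn.of_le_radius hle)

end Summit.AtomisticToContinuum.Crystallization.Theorems.FrustratedLawDichotomyStrainedPatchCoreTube
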